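import Summits.AtomisticToContinuum.HydrodynamicLimit.Theorems.HydroLimitInBand.Negative.SigmaZero
import HarnessLib

/-!
# `HydroLimitProfilewiseBand` (crux stmt-AtomisticToContinuum-17372), negative side: `0 < σ` is load-bearing
# (the PROFILE-WISE band with `0 ≤ σ` is false)

Landed by the standing crux disprover `refuter-cdisprove-stmt-AtomisticToContinuum-17372-0` (cycle 1, 2026-08-17;
`Cruxes/HydroLimitProfilewiseBand/Disproof.lean` §4) from the crux-strategist's checked artefact
`Cruxes/HydroLimitProfilewiseBand/NegationSigmaZero.lean` (planner-cstrat-…-17372-0, STRATEGY-CENSUS §Negation N1, which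
asked for exactly this landing). Content (all sorry-free):

The sibling crux's standing disprover proved `HydroLimitInBandNegative.hydroLimitInBand_false_with_sigma_zero :
¬ HydroLimitInBandWithZero` (`Theorems/HydroLimitInBand/Negative/SigmaZero.lean`, p123377): the UNIFORM band with `0 < σ`
relaxed to `0 ≤ σ` is false, by ONE profile — the stationary shear `(a₀, θ₀, u₀) = (1, 1, sin(2π x₁) e₀)` — and the free
flight at `σ = 0`. Because the witness is a single profile and the guard `ρ · 0³ < η` is trivial for EVERY `η > 0`, the
same witness refutes the relaxed PROFILE-WISE band (`∀ profiles ∃ η ∃ σ₀ ∀ σ, 0 ≤ σ → …`), whose negation is formally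
STRONGER than the sibling's (the `∀∃` statement being weaker): `hydroLimitProfilewiseBand_false_with_sigma_zero`.
So the `∀∃` weakening does not buy uniformity down to the ideal gas either: every threshold (`N₀`, `τ₀`, `σ₀`) of any
proof of stmt-17372 must degenerate as `σ ↓ 0`, exactly as for stmt-9133, and no line on this crux may be typed
`σ`-uniformly. `hydroLimitProfilewiseBand_of_withZero` records that the relaxed statement contains the crux (so this is
the strongest form in which `0 < σ` can be shown load-bearing), `profilewiseWithZero_of_inBandWithZero` the comparison
with the sibling (so `hydroLimitInBand_false_with_sigma_zero` follows back from the theorem here by composition).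
-/

noncomputable section

open MeasureTheory ProbabilityTheory Filter Set Topology Real
open scoped ENNReal NNReal InnerProductSpace

namespace Summit.AtomisticToContinuum.HydrodynamicLimit.Theorems.HydroLimitProfilewiseBandNegative

open Literature.MathematicalPhysics.KineticTheory Literature.Analysis.FluidPDE
open Literature.Analysis.FunctionSpaces
open Summit.AtomisticToContinuum.HydrodynamicLimit.Theses.ImplosionDichotomy (HydroLimitInBand HydroLimitProfilewiseBand)
open Summit.AtomisticToContinuum.HydrodynamicLimit.Theorems
open Summit.AtomisticToContinuum.HydrodynamicLimit.Theorems.HydroLimitInBandNegative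
open Summit.AtomisticToContinuum.HydrodynamicLimit.Theorems.CorrectorPressureDecayNegative.FreeFlow (freeFlow₀)

/-- The profile-wise band with `0 < σ` relaxed to `0 ≤ σ` (everything else verbatim the crux decl
`ImplosionDichotomy.HydroLimitProfilewiseBand`). -/
def HydroLimitProfilewiseBandWithZero : Prop :=
  ∀ (a₀ θ₀ : T3 → ℝ) (u₀ : T3 → V3), Continuous a₀ → Continuous θ₀ → Continuous u₀ →
    (∀ x, 0 < a₀ x) → (∀ x, 0 < θ₀ x) → ∃ η : ℝ, 0 < η ∧ ∃ σ₀ : ℝ, 0 < σ₀ ∧ ∀ σ : ℝ, 0 ≤ σ → σ < σ₀ →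
    ∀ (T : ℝ) (ρ θ : ℝ → T3 → ℝ) (u : ℝ → T3 → V3), IsHardSphereEulerSolution σ T ρ u θ →
    (∀ t ∈ Ico 0 T, ∀ x, ρ t x * σ ^ 3 < η) →
    ∀ Φ : (N : ℕ) → HardSphereFlow (Torus.geometry (Fin 3)) (hsDiameter σ N) (N + 1),
    TendstoHydroFieldsAt (fun N => localGibbsLaw σ a₀ u₀ θ₀ N (Φ N)) Φ ρ u θ 0 →
    ∀ t ∈ Ico 0 T, TendstoHydroFieldsAt (fun N => localGibbsLaw σ a₀ u₀ θ₀ N (Φ N)) Φ ρ u θ t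

/-- The relaxed profile-wise statement contains the crux (so its negation is the strongest form in which `0 < σ` can be
shown load-bearing for stmt-17372). [folklore] -/
theorem hydroLimitProfilewiseBand_of_withZero (h : HydroLimitProfilewiseBandWithZero) : HydroLimitProfilewiseBand := by
  intro a₀ θ₀ u₀ ha hθ hu ha0 hθ0
  obtain ⟨η, hη, σ₀, hσ₀, G⟩ := h a₀ θ₀ u₀ ha hθ hu ha0 hθ0
  exact ⟨η, hη, σ₀, hσ₀, fun σ hσ hσlt => G σ hσ.le hσlt⟩

/-- The relaxed UNIFORM statement of the sibling crux implies the relaxed profile-wise one (`η := η₀`), so the theorem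
below is formally stronger than `hydroLimitInBand_false_with_sigma_zero`. [folklore] -/
theorem profilewiseWithZero_of_inBandWithZero (h : HydroLimitInBandWithZero) : HydroLimitProfilewiseBandWithZero := by
  intro a₀ θ₀ u₀ ha hθ hu ha0 hθ0
  obtain ⟨η₀, hη₀, H⟩ := h
  exact ⟨η₀, hη₀, H a₀ θ₀ u₀ ha hθ hu ha0 hθ0⟩

/-- **`0 < σ` is load-bearing for the profile-wise band**: with `0 ≤ σ` the statement fails at the single profile
`(1, 1, shear)` for every packing threshold `η`, by free streaming of the shear equilibrium (momentum field at `t = 1`: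
Euler value `1/2` against the Knudsen value `e^{-2π²}/2`). The sibling disprover's proof
(`HydroLimitInBandNegative.hydroLimitInBand_false_with_sigma_zero`) with the profile fixed BEFORE the threshold.
[folklore] -/
theorem hydroLimitProfilewiseBand_false_with_sigma_zero : ¬ HydroLimitProfilewiseBandWithZero := by
  intro H
  obtain ⟨η₀, hη₀, σ₀, hσ₀, G⟩ := H (fun _ => 1) (fun _ => 1) shearVelocity continuous_const continuous_const
    continuous_shearVelocity (fun _ => one_pos) (fun _ => one_pos)
  have hE := isHardSphereEulerSolution_shear 0 2
  have hguard : ∀ s ∈ Ico (0 : ℝ) 2, ∀ x : T3, (fun (_ : ℝ) (_ : T3) => (1 : ℝ)) s x * (0 : ℝ) ^ 3 < η₀ :=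
    fun _ _ _ => by simpa using hη₀
  have h0 := tendstoHydroFieldsAt_zero_sigma_zero (θ₀ := fun _ => 1) (u₀ := shearVelocity) continuous_const
    continuous_shearVelocity (fun _ => one_pos) freeFlow₀
  have h1 := G 0 le_rfl hσ₀ 2 (fun _ _ => 1) (fun _ _ => 1) (fun _ x => shearVelocity x) hE hguard freeFlow₀ h0 1
    ⟨by norm_num, by norm_num⟩
  set I : V3 := ∫ x : T3, (shearProfile x * (1 : ℝ)) • shearVelocity x with hI
  have hI0 : I 0 = 1 / 2 := integral_shear_momentum_target_zero
  have hconv : ∀ δ > (0 : ℝ), Tendsto (fun N : ℕ => localGibbsMeasure 0 (fun _ => 1) shearVelocity (fun _ => 1) N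
      {z | δ < |empiricalMomentumField (freeFlight (Torus.geometry (Fin 3)) 1 z) shearProfile 0 - 1 / 2|})
      atTop (𝓝 0) := by
    intro δ hδ
    obtain ⟨-, hm, -⟩ := h1 shearProfile continuous_shearProfile δ hδ
    refine tendsto_of_tendsto_of_tendsto_of_le_of_le tendsto_const_nhds hm (fun N => bot_le) (fun N => ?_)
    beta_reduce
    rw [localGibbsLaw_eq]
    refine measure_mono fun z hz => ?_
    simp only [mem_setOf_eq] at hz
    show δ < ‖empiricalMomentumField (freeFlight (Torus.geometry (Fin 3)) 1 z) shearProfile - I‖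
    calc δ < |empiricalMomentumField (freeFlight (Torus.geometry (Fin 3)) 1 z) shearProfile 0 - 1 / 2| := hz
      _ = |(empiricalMomentumField (freeFlight (Torus.geometry (Fin 3)) 1 z) shearProfile - I) 0| := by
          rw [PiLp.sub_apply, hI0]
      _ ≤ _ := by
          have h := PiLp.norm_apply_le
            (empiricalMomentumField (freeFlight (Torus.geometry (Fin 3)) 1 z) shearProfile - I) 0
          rwa [Real.norm_eq_abs] at h
  have hK : ∀ δ > (0 : ℝ), Tendsto (fun N : ℕ => localGibbsMeasure 0 (fun _ => 1) shearVelocity (fun _ => 1) N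
      {z | δ < |empiricalMomentumField (freeFlight (Torus.geometry (Fin 3)) 1 z) shearProfile 0 -
        Real.exp (-(2 * π ^ 2 * 1 ^ 2)) * (1 / 2)|}) atTop (𝓝 0) := fun δ hδ => tendsto_momentum_freeStream 1 hδ
  have hP : ∀ᶠ N : ℕ in atTop,
      IsProbabilityMeasure (localGibbsMeasure 0 (fun _ => (1 : ℝ)) shearVelocity (fun _ => 1) N) :=
    Eventually.of_forall fun N => isProbabilityMeasure_localGibbsMeasure continuous_const continuous_const
      continuous_shearVelocity (fun _ => one_pos) (fun _ => one_pos) (by norm_num) N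
  have heq := DenseExcursionAtTimeZero.eq_of_tendsto_measure_lt_abs hP
    (F := fun N z => empiricalMomentumField (freeFlight (Torus.geometry (Fin 3)) 1 z) shearProfile 0) hconv hK
  have hlt : Real.exp (-(2 * π ^ 2 * 1 ^ 2)) < 1 := by
    rw [Real.exp_lt_one_iff]
    have hπ := Real.pi_pos
    nlinarith
  have h2 : Real.exp (-(2 * π ^ 2 * 1 ^ 2)) = 1 := by linear_combination (-2 : ℝ) * heq
  exact absurd h2 hlt.ne

end Summit.AtomisticToContinuum.HydrodynamicLimit.Theorems.HydroLimitProfilewiseBandNegative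

end
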